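import Summits.Schanuel.Schanuel.Theses.RigidCore
import Summits.Schanuel.Schanuel.Theorems.MinimalCounterexampleInAcl.Negative.FirstFailureEcl
import Summits.Schanuel.Schanuel.Theorems.MinimalCounterexampleInAcl.Negative.IsolationFree
import Literature.NumberTheory.Transcendental.TrdegZariskiDimConverse

/-!
# Route `RigidCore`, support item `MinimalCounterexampleInAclOfSparsityTwo` (stmt-Schanuel-14765)

The glue `SparsityTwo → MinimalCounterexampleInAclGeThree → MinimalCounterexampleInAcl` that puts the
rank-2 geometric sparsity crux `SparsityTwo` into the cone of the route's deciding theorem.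

Proof.  Let `x : Fin n → ℂ` be a first failure of Schanuel's conjecture (`x` ℚ-linearly independent,
`trdeg_ℚ ℚ(x, eˣ) < n`, `SchanuelRank r` for all `r < n`).
* `n ≤ 1` is impossible (`firstFailure_two_le`: rank `0` has `trdeg < 0`, rank `1` is
  Hermite–Lindemann).
* `n = 2`: by `exists_mem_indepExpPoints_of_trdeg_lt_two` (Noether normalisation, tree) the point
  `(x, eˣ)` lies on some `W ⊆ ℂ² × ℂ²` defined over the prime field with `zariskiDim ℂ W < 2`.  Every
  *locus mate* `x'` of `x` (`x'` ℚ-linearly independent and `(x', e^{x'})` satisfying every ℚ-polynomial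
  relation of `(x, eˣ)`) has `(x', e^{x'}) ∈ W`, because a polynomial with coefficients in the prime
  field `⊥ ≤ ℂ` is the image of a ℚ-polynomial (`ratToBot : ℚ →+* ⊥` is surjective).  So the locus
  mates of `x` form a subset of the finite set provided by `SparsityTwo`, and `isolationFree` (ℚ-linear
  independence and the locus condition are `∅`-definable in `ℂ_exp`; project to a coordinate) puts
  every `x i` in a finite `∅`-definable set.
* `n ≥ 3`: the co-premise `MinimalCounterexampleInAclGeThree`.

## References

* [Kirby2010] J. Kirby, *Exponential algebraicity in exponential fields*, Bull. LMS 42 (2010),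
  arXiv:0810.4285, Prop. 7.2.
* [KirbyMacintyreOnshuus2012] J. Kirby, A. Macintyre, A. Onshuus, *The algebraic numbers definable
  in various exponential fields*, J. Inst. Math. Jussieu 11 (2012), arXiv:1101.4224, §2.2.
* H. Matsumura, *Commutative Ring Theory*, CUP 1986, Thm 5.6 (dimension = transcendence degree).
-/

noncomputable section

set_option linter.dupNamespace false

open Complex Set
open Literature.NumberTheory.Transcendental
open Summit.Schanuel.Schanuel.Theorems.MinimalCounterexampleInAcl.Negative

namespace Summit.Schanuel.Schanuel.Theorems

/-- The coefficient map `ℚ → ⊥` into the prime field of `ℂ` is surjective: the prime field is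
contained in (hence equal to) the range of `ℚ → ℂ`. [folklore] -/
theorem ratToBot_surjective : Function.Surjective ratToBot := by
  intro c
  have h : (c : ℂ) ∈ (Rat.castHom ℂ).fieldRange :=
    (bot_le (a := (Rat.castHom ℂ).fieldRange)) c.2
  obtain ⟨q, hq⟩ := RingHom.mem_fieldRange.1 h
  refine ⟨q, Subtype.ext ?_⟩
  change (q : ℂ) = (c : ℂ)
  simpa using hq

/-- A set defined over the prime field is closed under passing to points satisfying the same
ℚ-polynomial relations: if `W` is the zero locus of polynomials with coefficients in `⊥ ≤ ℂ`,
`P ∈ W`, and `Q` satisfies every ℚ-relation of `P`, then `Q ∈ W`. [folklore] -/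
theorem mem_of_isDefinedOver_bot_of_relations {ι : Type} {W : Set (ι → ℂ)}
    (hW : IsDefinedOver (⊥ : Subfield ℂ) W) {P Q : ι → ℂ} (hP : P ∈ W)
    (hQ : ∀ p : MvPolynomial ι ℚ, MvPolynomial.aeval P p = 0 → MvPolynomial.aeval Q p = 0) :
    Q ∈ W := by
  obtain ⟨I, rfl⟩ := hW
  rw [MvPolynomial.mem_zeroLocus_iff] at hP ⊢
  intro f hf
  obtain ⟨g, rfl⟩ := MvPolynomial.map_surjective ratToBot ratToBot_surjective f
  have h1 := hP _ hf
  rw [aeval_map_ratToBot] at h1 ⊢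
  exact hQ g h1

/-- **Item stmt-Schanuel-14765 (`RigidCore.MinimalCounterexampleInAclOfSparsityTwo`), proved**:
`SparsityTwo → MinimalCounterexampleInAclGeThree → MinimalCounterexampleInAcl`.  Ranks `n ≤ 1` carry
no first failure (`firstFailure_two_le`); at rank `2` the point `(x, eˣ)` lies on a ℚ-variety
`W ⊆ ℂ² × ℂ²` of dimension `< 2` (`exists_mem_indepExpPoints_of_trdeg_lt_two`), every locus mate of `x`
lies on the same `W` (`mem_of_isDefinedOver_bot_of_relations`), so the locus mates are finitely many
by `SparsityTwo` and `isolationFree` isolates each coordinate `∅`-definably; ranks `n ≥ 3` are the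
co-premise. [folklore] -/
theorem minimalCounterexampleInAclOfSparsityTwo_proof :
    Summit.Schanuel.Schanuel.Theses.RigidCore.MinimalCounterexampleInAclOfSparsityTwo := by
  unfold Summit.Schanuel.Schanuel.Theses.RigidCore.MinimalCounterexampleInAclOfSparsityTwo
  intro hSp hGe n x hli htr hrank i
  rcases (firstFailure_two_le hli htr).eq_or_lt with h | h
  · subst h
    refine isolationFree hli ?_ i
    obtain ⟨W, hW, hd, hxW⟩ :=
      exists_mem_indepExpPoints_of_trdeg_lt_two hli (by exact_mod_cast htr)
    refine (hSp W hW hd).subset ?_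
    rintro x' ⟨hx', hrel⟩
    exact ⟨hx', mem_of_isDefinedOver_bot_of_relations hW hxW.2 hrel⟩
  · exact hGe n h x hli htr hrank i

/-- **The rank-2 slice of (S*) from `SparsityTwo` alone.**  A would-be counterexample to
Schanuel's conjecture of rank `2` (`x : Fin 2 → ℂ` ℚ-linearly independent with
`trdeg_ℚ ℚ(x, eˣ) < 2`) has every coordinate in a finite `∅`-definable subset of `ℂ_exp`, given only
the geometric sparsity crux `SparsityTwo` — neither the first-failure hypothesis
`∀ r < 2, SchanuelRank r` of (S*) nor the co-premise `MinimalCounterexampleInAclGeThree` is used at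
this rank (the former is in any case a theorem: ranks `0`, `1` hold).  This is the `n = 2` step of
`minimalCounterexampleInAclOfSparsityTwo_proof`, recorded as a standalone statement. [folklore] -/
theorem rankTwo_coordinates_definable_of_sparsityTwo
    (hSp : Summit.Schanuel.Schanuel.Theses.RigidCore.SparsityTwo) {x : Fin 2 → ℂ}
    (hli : LinearIndependent ℚ x)
    (htr : Algebra.trdeg ℚ ↥(IntermediateField.adjoin ℚ (Set.range x ∪ Set.range (Complex.exp ∘ x))) <
      (2 : Cardinal))
    (i : Fin 2) :
    ∃ s : Set ℂ, s.Finite ∧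
      Set.Definable₁ (∅ : Set ℂ) Literature.ModelTheory.ExponentialFields.Language.expRing s ∧ x i ∈ s := by
  refine isolationFree hli ?_ i
  obtain ⟨W, hW, hd, hxW⟩ := exists_mem_indepExpPoints_of_trdeg_lt_two hli htr
  refine (hSp W hW hd).subset ?_
  rintro x' ⟨hx', hrel⟩
  exact ⟨hx', mem_of_isDefinedOver_bot_of_relations hW hxW.2 hrel⟩

end Summit.Schanuel.Schanuel.Theorems

end
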